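import Summits.BirchSwinnertonDyer.Rank1Residual.GaloisImage.TransverseCupProductVanishing
import Literature.NumberTheory.GaloisRepresentations.LocalTatePairing
import Literature.NumberTheory.GaloisRepresentations.KummerSES
import Summits.BirchSwinnertonDyer.Rank1Residual.GaloisImage.KolyvaginPrimeTransverse
import HarnessLib

/-!
# Transverse classes cup to ZERO at odd `n`: the orthogonality half of Mazur–Rubin Prop. 1.3.2 (ii)
# as a KERNEL theorem for EVERY family of local invariant maps
# (cell `b2b-bsdres`, team n1011, row T-M2p-K = R1-23 located gap M2′; seat p04 GEN 6; file 2/3)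

HONEST FRAMING (cell `b2b-bsdres`, run/shared/lean/b2b/bsd-rank1-residual/, verbatim in every
file): the goal of the cell is to DELETE the COMBINATION-SHAPED residual classes of the
Birch–Swinnerton-Dyer formula for ALL analytic-rank `≤ 1` elliptic curves over `ℚ` — "full BSD
formula for every rank `≤ 1` curve in class `C`" assembled STRICTLY from published theorems — so
that the rank-`≤ 1` remainder becomes exactly the CONSTRUCTION-SHAPED classes, which are TYPED
(missing-input `Prop`s), NOT attempted. This is not "finishing BSD". Team n1011 (N10 / N11, the
additive block X4 ∧ `p = 3`): research route on the CONSTRUCTION-SHAPED class X4 (§I N11); no claim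
beyond the stated classes; nothing is booked; no mark / label is changed by this file. Theorems
only (no definition, no named fact, no `sorry`); TOOL theorems of local Galois cohomology.

## What and why

Mazur–Rubin, *Kolyvagin systems* (2004) Prop. 1.3.2 (ii) / Rubin, PCMI 18 (2011) Prop. 1.9.5 (4):
"`H¹_tr(K,T)` and `H¹_tr(K,T^*)` are orthogonal complements under `⟨ , ⟩`", typed by n1011-lit as
the predicate `LocalInvariants.TransverseOrthogonal` on a family of local invariant maps
(`Literature/NumberTheory/GaloisCohomology/PoitouTateTransverseDuality.lean`; the consumer is p18's
R1-23 binder `hTr`).  THIS FILE: at ODD `n` the ORTHOGONALITY holds for EVERY additive `inv_v` — no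
class field theory, no norm groups, not even `n ∣ [L : K_v]` — by `TransverseCupProductVanishing`.
Setting: a number field `K`, a finite discrete `Γ_K`-module `M`, a finite place `v`, a prime `ℓ`
invertible in `K_v`, `L = K_v(μ_ℓ) = CyclotomicField ℓ K_v`, `χ̄_ℓ` the mod-`ℓ` cyclotomic
character of `Γ_{K_v}` (image `≤ (ℤ/ℓ)ˣ`, cyclic); hypotheses: `n` ODD, the inertia group of `K_v`
acts trivially on `M` AND on `M^D = Hom(M, μₙ)` (both unramified), and `χ̄_ℓ` maps the inertia group
onto `(ℤ/ℓ)ˣ` (p18's `hχI`; a theorem for `K = ℚ`,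
`Rat.exists_mem_absInertia_adicCompletion_modPCyclotomicCharacterZMod_eq`), so that
`M^{Γ_L} = M^{Γ_{K_v}}` (p18's `apply_eq_self_of_forall_ker`) and the transverse classes are the
classes principal on `ker χ̄_ℓ = Γ_L` (p18's `mem_transverseSubgroup_cyclotomicField_iff`).

* **`localTatePairing_eq_zero_of_mem_transverseSubgroup`: `a ∪ b = 0` in `H²(K_v, μₙ)` for
  `a ∈ H¹_tr(K_v, M)`, `b ∈ H¹_tr(K_v, M^D)`** (`exists_forall_modPCyclotomicCharacterZMod_eq_pow`:
  the image of `χ̄_ℓ` is generated by one value);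
* `localTatePairingZMod_eq_zero_of_mem_transverseSubgroup`: `⟨a, b⟩_v = inv_v(a ∪ b) = 0` for
  EVERY additive `inv_v : H²(K_v, μₙ) → ℤ/n`;
* **`transverseSubgroup_tateDual_le_dualLocalCondition`: `H¹_tr(K_v, M^D) ≤ (H¹_tr(K_v, M))^*` for
  EVERY family `inv : LocalInvariants K n`** — the inclusion half of `TransverseOrthogonal` as a
  theorem about all families; the sequel `TransverseOrthogonal.lean` adds the complement half from
  `IsPerfect` + `UnramifiedOrthogonal`.

"Odd" is sharp: at `n = 2`, `K = ℚ`, `v = 3`, `M = ℤ/2`, `L = ℚ₃(μ₃)` both transverse subgroups are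
`⟨[−3]⟩ ≤ ℚ₃ˣ/ℚ₃ˣ²` and `(−3, −3)₃ = −1`; Mazur–Rubin's "simple computation
`N_{L/K}β = α^{|F^×|/p^k}`" holds up to the sign `∏_{ζ ∈ μ_{p^k}} ζ`, so the printed Prop. 1.3.2 (ii)
tacitly needs `p` odd.  Consistency at odd `n`: the class of `α ∪ β` in `H²(Gal(L/K_v), μₙ) ≅ μₙ`
is `binom(d,2)·ζ`, `d = [L : K_v]`, zero for odd `n ∣ d`.

Technical note (for GaloisImage writers): type-class synthesis fails on goals mixing the
`Place.Completion (Sum.inr v)`-typed local objects (`ρ.toLocal (Sum.inr v)`, `localTatePairing`) with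
the `v.adicCompletion K`-typed ones (`GaloisRep.toLocal v ρ`, `absInertia`,
`modPCyclotomicCharacterZMod`): the classes `a`, `b` are typed over `v.adicCompletion K` and the proof
`change`s the goal to the evaluation pairing spelled out over `v.adicCompletion K`
(`DiscreteGaloisModule.pairing … (tateDualEval K M n) …`, definitionally
`tateDualPairingLocal ρ n (Sum.inr v)`); consumers with `Place.Completion`-typed classes apply the
theorems as they are (the types agree definitionally).

References: B. Mazur, K. Rubin, Mem. AMS 168 (2004) no. 799, Def. 1.1.6, Prop. 1.3.2 (ii) (p. 12)
[MazurRubin2004]; K. Rubin, PCMI 18 (2011), Def. 1.9.4, Prop. 1.9.5 (4) (p. 14) [Rubin2011];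
J.-P. Serre, *Local Fields* (1979), IV §4 Prop. 17–18 and XIV §2 (Hilbert symbol, for the `n = 2`
remark) [SerreLocalFields1979].
-/

noncomputable section

open CategoryTheory Function
open scoped ContRepresentation

universe u

namespace Summit.BirchSwinnertonDyer.Rank1Residual.GaloisImage

namespace TransverseCup

open Literature.NumberTheory.GaloisRepresentations
open _root_.TopRep _root_.ContRepresentation _root_.ContinuousCohomology

/-! ## §L. The local instance: cyclotomic-transverse classes cup to zero at odd `n` -/

section Local

open NumberField IsDedekindDomain Field
open Literature.NumberTheory.GaloisCohomology
open scoped NumberField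

variable {K : Type u} [Field K] [NumberField K] {M : Type u} [AddCommGroup M] [TopologicalSpace M]
  [DiscreteTopology M] [Finite M] (ρ : DiscreteGaloisModule K M) (n : ℕ)
  (v : HeightOneSpectrum (𝓞 K)) (ℓ : ℕ) [Fact ℓ.Prime] [NeZero ((ℓ : ℕ) : v.adicCompletion K)]

/-- The image of the mod-`ℓ` cyclotomic character `χ̄_ℓ : Γ_{K_v} → (ℤ/ℓ)ˣ` is generated by one value:
`(ℤ/ℓ)ˣ` is cyclic (`IsCyclic.exists_generator`) and `χ̄_ℓ` is onto (already on the inertia group,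
hypothesis `hχI`). [folklore] -/
theorem exists_forall_modPCyclotomicCharacterZMod_eq_pow
    (hχI : ∀ u : (ZMod ℓ)ˣ, ∃ t ∈ absInertia (v.adicCompletion K),
      modPCyclotomicCharacterZMod (v.adicCompletion K) ℓ t = u) :
    ∃ σ : absoluteGaloisGroup (v.adicCompletion K), ∀ s : absoluteGaloisGroup (v.adicCompletion K),
      ∃ i : ℕ, modPCyclotomicCharacterZMod (v.adicCompletion K) ℓ s =
        modPCyclotomicCharacterZMod (v.adicCompletion K) ℓ σ ^ i := by
  obtain ⟨u0, hu0⟩ := IsCyclic.exists_generator (α := (ZMod ℓ)ˣ)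
  obtain ⟨σ, -, hσ⟩ := hχI u0
  refine ⟨σ, fun s => ?_⟩
  have hs : modPCyclotomicCharacterZMod (v.adicCompletion K) ℓ s ∈ Submonoid.powers u0 :=
    (IsOfFinOrder.mem_powers_iff_mem_zpowers (isOfFinOrder_of_finite u0)).2 (hu0 _)
  obtain ⟨i, hi⟩ := (Submonoid.mem_powers_iff _ _).1 hs
  exact ⟨i, by rw [hσ, hi]⟩

/-- **Transverse classes cup to zero at odd `n`, in the tree's local Tate pairing
`localTatePairing ρ n (Sum.inr v) : H¹(K_v, M) × H¹(K_v, M^D) → H²(K_v, μₙ)`.**  For a finite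
discrete `Γ_K`-module `M`, `n` ODD, a finite place `v` and a prime `ℓ` invertible in `K_v` such that
the inertia group of `K_v` acts trivially on `M|_v` AND on `M^D|_v = Hom(M, μₙ)|_v` and `χ̄_ℓ` maps
the inertia group onto `(ℤ/ℓ)ˣ` (so `L = K_v(μ_ℓ)/K_v` is totally ramified with cyclic group): for
`a ∈ H¹_tr(K_v, M) = ker(H¹(K_v, M) → H¹(L, M))` and `b ∈ H¹_tr(K_v, M^D)`, `a ∪ b = 0` in
`H²(K_v, μₙ)` (cup product for the evaluation pairing `M × M^D → μₙ`).  Proof: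
`cupProduct_eq_zero_of_principal_of_cyclic` with `χ = χ̄_ℓ`, the transverse classes being the
classes principal on `ker χ̄_ℓ = Γ_L` (p18's `mem_transverseSubgroup_cyclotomicField_iff`),
`M^{Γ_L} = M^{Γ_{K_v}}` (p18's `apply_eq_self_of_forall_ker`), `μₙ` killed by `n`
(`zsmul_muCarrier_eq_zero`); the computation runs over `v.adicCompletion K` (see the technical note
in the module docstring; the classes `a`, `b` are typed there, definitionally the same groups as at
the place `Sum.inr v`).  The ORTHOGONALITY half of Mazur–Rubin Prop. 1.3.2 (ii) / Rubin PCMI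
Prop. 1.9.5 (4), at odd `n`, with NO class field theory and for a general number field `K`.
[cite: MazurRubin2004, Prop. 1.3.2 (ii) (p. 12)] [cite: Rubin2011, Prop. 1.9.5 (4) (p. 14)] -/
theorem localTatePairing_eq_zero_of_mem_transverseSubgroup (hn : Odd n)
    (hI : ∀ t ∈ absInertia (v.adicCompletion K), ∀ m : M, GaloisRep.toLocal v ρ t m = m)
    (hID : ∀ t ∈ absInertia (v.adicCompletion K), ∀ f : DiscreteGaloisModule.TateDual K M n,
      GaloisRep.toLocal v (ρ.tateDual n) t f = f)
    (hχI : ∀ u : (ZMod ℓ)ˣ, ∃ t ∈ absInertia (v.adicCompletion K),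
      modPCyclotomicCharacterZMod (v.adicCompletion K) ℓ t = u)
    {a : galoisCohomology (GaloisRep.toLocal v ρ) 1}
    (ha : a ∈ DiscreteGaloisModule.transverseSubgroup (GaloisRep.toLocal v ρ)
      (CyclotomicField ℓ (v.adicCompletion K)))
    {b : galoisCohomology (GaloisRep.toLocal v (ρ.tateDual n)) 1}
    (hb : b ∈ DiscreteGaloisModule.transverseSubgroup (GaloisRep.toLocal v (ρ.tateDual n))
      (CyclotomicField ℓ (v.adicCompletion K))) :
    DiscreteGaloisModule.localTatePairing ρ n (Sum.inr v) a b = 0 := by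
  classical
  haveI := absoluteGaloisGroup_compactSpace (v.adicCompletion K)
  obtain ⟨k, hk⟩ := hn
  -- the evaluation pairing, typed over `v.adicCompletion K` (definitionally `tateDualPairingLocal`)
  change (DiscreteGaloisModule.pairing (GaloisRep.toLocal v ρ) (GaloisRep.toLocal v (ρ.tateDual n))
      (GaloisRep.toLocal v (DiscreteGaloisModule.mu K n)) (DiscreteGaloisModule.tateDualEval K M n)
      (fun _ m f => DiscreteGaloisModule.tateDualEval_smul ρ n _ m f)).cupProduct a b = 0
  refine cupProduct_eq_zero_of_principal_of_cyclic _ (modPCyclotomicCharacterZMod (v.adicCompletion K) ℓ)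
    a b (fun x => ?_) (fun y => ?_) (fun s x hx => ?_) (fun s y hy => ?_) (fun f hf => ?_)
    (fun g hg => ?_) (exists_forall_modPCyclotomicCharacterZMod_eq_pow v ℓ hχI) k (fun z => ?_)
  · exact (GaloisRep.toLocal v ρ).continuous_apply_left x
  · exact (GaloisRep.toLocal v (ρ.tateDual n)).continuous_apply_left y
  · exact apply_eq_self_of_forall_ker (GaloisRep.toLocal v ρ) ℓ hI hχI s x
      fun h hh => hx h (MonoidHom.mem_ker.1 hh)
  · exact apply_eq_self_of_forall_ker (GaloisRep.toLocal v (ρ.tateDual n)) ℓ hID hχI s y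
      fun h hh => hy h (MonoidHom.mem_ker.1 hh)
  · rw [← hf] at ha
    exact (mem_transverseSubgroup_cyclotomicField_iff (GaloisRep.toLocal v ρ) ℓ f).1 ha
  · rw [← hg] at hb
    exact (mem_transverseSubgroup_cyclotomicField_iff (GaloisRep.toLocal v (ρ.tateDual n)) ℓ g).1 hb
  · rw [← hk, ← natCast_zsmul]
    exact zsmul_muCarrier_eq_zero K n z

/-- **`⟨a, b⟩_v = inv_v(a ∪ b) = 0` for transverse `a`, `b` at odd `n`, for EVERY additive
`inv_v : H²(K_v, μₙ) → ℤ/n`** (no property of `inv_v` is used: `a ∪ b = 0` already).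
[cite: MazurRubin2004, Prop. 1.3.2 (ii) (p. 12)] -/
theorem localTatePairingZMod_eq_zero_of_mem_transverseSubgroup (hn : Odd n)
    (hI : ∀ t ∈ absInertia (v.adicCompletion K), ∀ m : M, GaloisRep.toLocal v ρ t m = m)
    (hID : ∀ t ∈ absInertia (v.adicCompletion K), ∀ f : DiscreteGaloisModule.TateDual K M n,
      GaloisRep.toLocal v (ρ.tateDual n) t f = f)
    (hχI : ∀ u : (ZMod ℓ)ˣ, ∃ t ∈ absInertia (v.adicCompletion K),
      modPCyclotomicCharacterZMod (v.adicCompletion K) ℓ t = u)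
    (inv : galoisCohomology ((DiscreteGaloisModule.mu K n).toLocal (Sum.inr v)) 2 →+ ZMod n)
    {a : galoisCohomology (GaloisRep.toLocal v ρ) 1}
    (ha : a ∈ DiscreteGaloisModule.transverseSubgroup (GaloisRep.toLocal v ρ)
      (CyclotomicField ℓ (v.adicCompletion K)))
    {b : galoisCohomology (GaloisRep.toLocal v (ρ.tateDual n)) 1}
    (hb : b ∈ DiscreteGaloisModule.transverseSubgroup (GaloisRep.toLocal v (ρ.tateDual n))
      (CyclotomicField ℓ (v.adicCompletion K))) :
    DiscreteGaloisModule.localTatePairingZMod ρ n (Sum.inr v) inv a b = 0 := by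
  rw [DiscreteGaloisModule.localTatePairingZMod_apply,
    localTatePairing_eq_zero_of_mem_transverseSubgroup ρ n v ℓ hn hI hID hχI ha hb, map_zero]

/-- **`H¹_tr(K_v, M^D) ≤ (H¹_tr(K_v, M))^*` for EVERY family `inv : LocalInvariants K n`, `n` odd**
(`L = K_v(μ_ℓ)`, `M` and `M^D` unramified at `v`, `χ̄_ℓ` onto on inertia): the inclusion half of
"`H¹_tr(K,T)` and `H¹_tr(K,T^*)` are orthogonal complements under `⟨ , ⟩`" (Mazur–Rubin
Prop. 1.3.2 (ii)), i.e. of n1011-lit's predicate `LocalInvariants.TransverseOrthogonal`, as a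
theorem about ALL families; the complement half needs `IsPerfect` (sequel file).
[cite: MazurRubin2004, Prop. 1.3.2 (ii) (p. 12)] [cite: Rubin2011, Prop. 1.9.5 (4) (p. 14)] -/
theorem transverseSubgroup_tateDual_le_dualLocalCondition (hn : Odd n)
    (hI : ∀ t ∈ absInertia (v.adicCompletion K), ∀ m : M, GaloisRep.toLocal v ρ t m = m)
    (hID : ∀ t ∈ absInertia (v.adicCompletion K), ∀ f : DiscreteGaloisModule.TateDual K M n,
      GaloisRep.toLocal v (ρ.tateDual n) t f = f)
    (hχI : ∀ u : (ZMod ℓ)ˣ, ∃ t ∈ absInertia (v.adicCompletion K),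
      modPCyclotomicCharacterZMod (v.adicCompletion K) ℓ t = u)
    (inv : LocalInvariants K n) :
    DiscreteGaloisModule.transverseSubgroup (GaloisRep.toLocal v (ρ.tateDual n))
        (CyclotomicField ℓ (v.adicCompletion K)) ≤
      inv.dualLocalCondition ρ (Sum.inr v)
        (DiscreteGaloisModule.transverseSubgroup (GaloisRep.toLocal v ρ)
          (CyclotomicField ℓ (v.adicCompletion K))) :=
  fun _ hb _ ha =>
    localTatePairingZMod_eq_zero_of_mem_transverseSubgroup ρ n v ℓ hn hI hID hχI _ ha hb

end Local

end TransverseCup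

end Summit.BirchSwinnertonDyer.Rank1Residual.GaloisImage

end
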